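import Mathlib.Combinatorics.SetFamily.Shatter
import Mathlib.LinearAlgebra.FiniteDimensional.Lemmas
import Mathlib.Data.Real.Basic
import Mathlib.Algebra.Order.BigOperators.Group.Finset
import Mathlib.Tactic

/-!
# Positivity-set families: a VC bound (Dudley) and an averaging lemma

Support file for crux `ConvexGateBlind` (stmt-PneNP-10680), line `xor-door-perfect-completeness`, open
stub `stub_exactLifting` (prover seat 0, session 20; memo ANALYSIS10). Generic combinatorics used by the
LINE-MODEL lower bound for the triangle instance (`…ExactLiftingTriangleLine.lean`):

* `posSet g = {d | 0 < g d}`; a family `Fam` of subsets of `Fin t` is a positivity family of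
  `g : ι → (Fin t → ℝ)` when every member is the positivity set of a real linear combination of the `g i`
  (kept as an explicit hypothesis).
* DUDLEY'S BOUND `card_le_of_shatters`: such a family shatters no set of more than `card ι` points
  (linear algebra: a non-zero vector `w` supported on the shattered set and orthogonal to all `g i` exists by
  dimension count; shattering the positive part of `w` gives a combination `G` with `∑ w d * G d > 0`,
  contradiction). Hence `vcDim ≤ k` and, by the Sauer–Shelah–Pajor lemma of Mathlib,
  `#Fam ≤ ∑_{i ≤ k} C(t, i) ≤ 2 t^k`, `k = card ι` (`card_posFamily_le`, `card_posFamily_le_pow`).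
* AVERAGING `sum_maxIn_le`: if `#Fam ≤ 2^k` then `∑_{C ⊆ Fin t} max{#U : U ∈ Fam, U ⊆ C} ≤ 2^t (k + 1)` — a
  uniformly random subset of `Fin t` contains, on average, no member of `Fam` of size much above `log₂ #Fam`.
-/

set_option linter.dupNamespace false -- `Summit.PneNP.PneNP.…`: summit = sub-problem (D-0017)

namespace Summit.PneNP.PneNP.Theorems.XorDoor.TriLine

open Finset

noncomputable section

/-- The positivity set `{d | 0 < g d}` of a real function on `Fin t`. -/
def posSet {t : ℕ} (g : Fin t → ℝ) : Finset (Fin t) := univ.filter fun d => 0 < g d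

/-- membership in the positivity set -/
@[simp] lemma mem_posSet {t : ℕ} (g : Fin t → ℝ) (d : Fin t) : d ∈ posSet g ↔ 0 < g d := by
  simp [posSet]

/-- Dudley's bound: a positivity family of `k` functions shatters no set with more than `k` elements. -/
theorem card_le_of_shatters {t : ℕ} {ι : Type*} [Fintype ι] (g : ι → Fin t → ℝ)
    {Fam : Finset (Finset (Fin t))}
    (hFam : ∀ U ∈ Fam, ∃ c : ι → ℝ, U = posSet (fun d => ∑ i, c i * g i d)) {s : Finset (Fin t)}
    (hs : Fam.Shatters s) : #s ≤ Fintype.card ι := by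
  by_contra hlt
  have hlt : Fintype.card ι < #s := not_le.1 hlt
  -- the linear map `w ↦ (∑_{d ∈ s} w d * g i d)_i` from `s → ℝ` to `Fin k → ℝ` has a non-trivial kernel
  let T : (s → ℝ) →ₗ[ℝ] (ι → ℝ) :=
    { toFun := fun w i => ∑ d : s, w d * g i d
      map_add' := by
        intro w w'
        funext i
        simp only [Pi.add_apply, add_mul, sum_add_distrib]
      map_smul' := by
        intro r w
        funext i
        simp only [Pi.smul_apply, smul_eq_mul, RingHom.id_apply, mul_sum, mul_assoc] }
  have hdim : Module.finrank ℝ (ι → ℝ) < Module.finrank ℝ (s → ℝ) := by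
    rw [Module.finrank_fintype_fun_eq_card, Module.finrank_fintype_fun_eq_card, Fintype.card_coe]
    exact hlt
  have hker := LinearMap.ker_ne_bot_of_finrank_lt (f := T) hdim
  rw [Submodule.ne_bot_iff] at hker
  obtain ⟨w, hw, hw0⟩ := hker
  have hTw : ∀ i, ∑ d : s, w d * g i d = 0 := fun i => by
    have := congrArg (fun f => f i) (LinearMap.mem_ker.1 hw)
    simpa [T] using this
  -- some coordinate of `w` is non-zero; flip the sign of `w` so that it is positive
  obtain ⟨d₀, hd₀⟩ : ∃ d₀ : s, w d₀ ≠ 0 := by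
    by_contra h
    exact hw0 (funext fun d => Classical.not_not.1 fun hd => h ⟨d, hd⟩)
  let σ : ℝ := if 0 < w d₀ then 1 else -1
  let W : Fin t → ℝ := fun d => if h : d ∈ s then σ * w ⟨d, h⟩ else 0
  have hWs : ∀ (G : Fin t → ℝ), ∑ d ∈ s, W d * G d = σ * ∑ d : s, w d * G d := by
    intro G
    rw [← sum_coe_sort s, mul_sum]
    refine sum_congr rfl fun d _ => ?_
    simp [W, d.2, mul_assoc]
  have hWd₀ : 0 < W d₀ := by
    have : W d₀ = σ * w d₀ := by simp [W, d₀.2]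
    rw [this]
    dsimp only [σ]
    split_ifs with h
    · simpa using h
    · have : w d₀ < 0 := lt_of_le_of_ne (not_lt.1 h) hd₀
      nlinarith
  -- the positive part of `W` inside `s`
  set P : Finset (Fin t) := s.filter fun d => 0 < W d with hP
  have hPs : P ⊆ s := filter_subset _ _
  obtain ⟨U, hUFam, hsU⟩ := hs hPs
  obtain ⟨c, rfl⟩ := hFam U hUFam
  set G : Fin t → ℝ := fun d => ∑ i, c i * g i d with hG
  -- `∑_{d ∈ s} W d * G d = 0` by orthogonality …
  have hzero : ∑ d ∈ s, W d * G d = 0 := by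
    rw [hWs]
    have : ∑ d : s, w d * G d = ∑ i, c i * ∑ d : s, w d * g i d := by
      simp only [hG, mul_sum]
      rw [sum_comm]
      refine sum_congr rfl fun i _ => sum_congr rfl fun d _ => ?_
      ring
    rw [this]
    have h0 : ∑ i, c i * ∑ d : s, w d * g i d = 0 :=
      sum_eq_zero fun i _ => by rw [hTw i, mul_zero]
    rw [h0, mul_zero]
  -- … but every term is `≥ 0` and the term at `d₀` is `> 0`
  have hterm : ∀ d ∈ s, 0 ≤ W d * G d := by
    intro d hd
    by_cases hWd : 0 < W d
    · have hdP : d ∈ P := by rw [hP]; exact mem_filter.2 ⟨hd, hWd⟩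
      have hdU : d ∈ posSet G := by
        have : d ∈ s ∩ posSet G := by rw [hsU]; exact hdP
        exact (mem_inter.1 this).2
      exact mul_nonneg hWd.le (le_of_lt ((mem_posSet G d).1 hdU))
    · have hdP : d ∉ P := by rw [hP]; simp [hWd]
      have hdU : d ∉ posSet G := by
        intro h'
        exact hdP (by rw [← hsU]; exact mem_inter.2 ⟨hd, h'⟩)
      have hGd : G d ≤ 0 := not_lt.1 (mt (mem_posSet G d).2 hdU)
      exact mul_nonneg_of_nonpos_of_nonpos (not_lt.1 hWd) hGd
  have hpos : 0 < W d₀ * G d₀ := by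
    have hdP : (d₀ : Fin t) ∈ P := by rw [hP]; exact mem_filter.2 ⟨d₀.2, hWd₀⟩
    have hdU : (d₀ : Fin t) ∈ posSet G := by
      have : (d₀ : Fin t) ∈ s ∩ posSet G := by rw [hsU]; exact hdP
      exact (mem_inter.1 this).2
    exact mul_pos hWd₀ ((mem_posSet G d₀).1 hdU)
  have : 0 < ∑ d ∈ s, W d * G d :=
    sum_pos' hterm ⟨d₀, d₀.2, hpos⟩
  linarith

/-- Hence the VC dimension of a positivity family of `card ι` functions is at most `card ι`. -/
theorem vcDim_posFamily_le {t : ℕ} {ι : Type*} [Fintype ι] (g : ι → Fin t → ℝ)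
    {Fam : Finset (Finset (Fin t))}
    (hFam : ∀ U ∈ Fam, ∃ c : ι → ℝ, U = posSet (fun d => ∑ i, c i * g i d)) :
    Fam.vcDim ≤ Fintype.card ι :=
  Finset.sup_le fun _ hs => card_le_of_shatters g hFam (mem_shatterer.1 hs)

/-- Sauer–Shelah–Pajor: a positivity family of `k = card ι` functions on `Fin t` has at most `∑_{i ≤ k} C(t,i)`
members. -/
theorem card_posFamily_le {t : ℕ} {ι : Type*} [Fintype ι] (g : ι → Fin t → ℝ)
    {Fam : Finset (Finset (Fin t))}
    (hFam : ∀ U ∈ Fam, ∃ c : ι → ℝ, U = posSet (fun d => ∑ i, c i * g i d)) :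
    #Fam ≤ ∑ i ∈ range (Fintype.card ι + 1), t.choose i := by
  calc #Fam ≤ #Fam.shatterer := card_le_card_shatterer Fam
    _ ≤ ∑ i ∈ Iic Fam.vcDim, (Fintype.card (Fin t)).choose i := card_shatterer_le_sum_vcDim
    _ ≤ ∑ i ∈ range (Fintype.card ι + 1), t.choose i := by
      rw [Fintype.card_fin]
      apply sum_le_sum_of_subset_of_nonneg
      · intro i hi
        have := vcDim_posFamily_le g hFam
        simp only [mem_Iic] at hi
        simp only [mem_range]
        omega
      · intro _ _ _
        exact Nat.zero_le _

/-- `∑_{i ≤ D} C(t, i) ≤ 2 t^D` for `t ≥ 2`. -/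
theorem sum_choose_le_two_mul_pow {t : ℕ} (ht : 2 ≤ t) (D : ℕ) :
    ∑ i ∈ range (D + 1), t.choose i ≤ 2 * t ^ D := by
  induction D with
  | zero => simp
  | succ D ih =>
    rw [sum_range_succ]
    have h1 : t.choose (D + 1) ≤ t ^ (D + 1) := Nat.choose_le_pow t (D + 1)
    have h2 : 2 * t ^ D ≤ t ^ (D + 1) := by
      rw [pow_succ]
      nlinarith [pow_pos (by omega : 0 < t) D]
    omega

/-- A positivity family of `k = card ι` functions on `Fin t` (`t ≥ 2`) has at most `2 t^k` members. -/
theorem card_posFamily_le_pow {t : ℕ} (ht : 2 ≤ t) {ι : Type*} [Fintype ι] (g : ι → Fin t → ℝ)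
    {Fam : Finset (Finset (Fin t))}
    (hFam : ∀ U ∈ Fam, ∃ c : ι → ℝ, U = posSet (fun d => ∑ i, c i * g i d)) :
    #Fam ≤ 2 * t ^ Fintype.card ι :=
  (card_posFamily_le g hFam).trans (sum_choose_le_two_mul_pow ht _)

/-! ## The averaging lemma -/

/-- `maxIn Fam C` = the largest cardinality of a member of `Fam` contained in `C` (`0` if there is none). -/
def maxIn {t : ℕ} (Fam : Finset (Finset (Fin t))) (C : Finset (Fin t)) : ℕ :=
  (Fam.filter (· ⊆ C)).sup card

/-- Any member of `Fam` inside `C` has cardinality `≤ maxIn Fam C`. -/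
lemma card_le_maxIn {t : ℕ} {Fam : Finset (Finset (Fin t))} {C U : Finset (Fin t)} (hU : U ∈ Fam)
    (hUC : U ⊆ C) : #U ≤ maxIn Fam C :=
  Finset.le_sup (f := card) (mem_filter.2 ⟨hU, hUC⟩)

/-- `maxIn Fam C ≤ k + ∑_{U ∈ Fam, U ⊆ C} (#U − k)`. -/
lemma maxIn_le_add_sum {t : ℕ} (Fam : Finset (Finset (Fin t))) (C : Finset (Fin t)) (k : ℕ) :
    maxIn Fam C ≤ k + ∑ U ∈ Fam.filter (· ⊆ C), (#U - k) := by
  unfold maxIn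
  refine Finset.sup_le fun U hU => ?_
  have : #U - k ≤ ∑ U ∈ Fam.filter (· ⊆ C), (#U - k) :=
    single_le_sum (f := fun U => #U - k) (fun _ _ => Nat.zero_le _) hU
  omega

/-- The number of supersets of `U` inside `Fin t` is at most `2^(t − #U)`. -/
lemma card_supersets_le {t : ℕ} (U : Finset (Fin t)) :
    #(univ.filter fun C : Finset (Fin t) => U ⊆ C) ≤ 2 ^ (t - #U) := by
  have hpow : #((univ \ U).powerset) = 2 ^ (t - #U) := by
    rw [card_powerset, card_sdiff_of_subset (subset_univ U), card_univ, Fintype.card_fin]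
  rw [← hpow]
  refine card_le_card_of_injOn (fun C => C \ U) (fun C hC => ?_) (fun C hC C' hC' h => ?_)
  · simp only [coe_filter, mem_univ, true_and, Set.mem_setOf_eq] at hC
    exact mem_powerset.2 (sdiff_subset_sdiff (subset_univ C) le_rfl)
  · simp only [coe_filter, mem_univ, true_and, Set.mem_setOf_eq] at hC hC'
    have h' : C \ U = C' \ U := h
    rw [← sdiff_union_of_subset hC, ← sdiff_union_of_subset hC', h']

/-- `(u − k) 2^(t−u) ≤ 2^(t−k−1)` for `u ≤ t`. -/
lemma sub_mul_pow_le {t k u : ℕ} (hu : u ≤ t) : (u - k) * 2 ^ (t - u) ≤ 2 ^ (t - k - 1) := by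
  rcases Nat.lt_or_ge k u with h | h
  · -- u = k + j with j ≥ 1, t = u + m
    obtain ⟨j, rfl⟩ : ∃ j, u = k + 1 + j := ⟨u - (k + 1), by omega⟩
    obtain ⟨m, rfl⟩ : ∃ m, t = k + 1 + j + m := ⟨t - (k + 1 + j), by omega⟩
    have e1 : k + 1 + j - k = j + 1 := by omega
    have e2 : k + 1 + j + m - (k + 1 + j) = m := by omega
    have e3 : k + 1 + j + m - k - 1 = j + m := by omega
    rw [e1, e2, e3, pow_add]
    have : j + 1 ≤ 2 ^ j := Nat.lt_two_pow_self
    exact Nat.mul_le_mul_right _ this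
  · have : u - k = 0 := by omega
    simp [this]

/-- AVERAGING LEMMA. If `#Fam ≤ 2^k` then `∑_C maxIn Fam C ≤ 2^t (k+1)`, the sum over all `C ⊆ Fin t`. -/
theorem sum_maxIn_le {t k : ℕ} (Fam : Finset (Finset (Fin t))) (hFam : #Fam ≤ 2 ^ k) :
    ∑ C : Finset (Fin t), maxIn Fam C ≤ 2 ^ t * (k + 1) := by
  classical
  have step1 : ∑ C : Finset (Fin t), maxIn Fam C
      ≤ ∑ C : Finset (Fin t), (k + ∑ U ∈ Fam.filter (· ⊆ C), (#U - k)) :=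
    sum_le_sum fun C _ => maxIn_le_add_sum Fam C k
  have step2 : ∑ C : Finset (Fin t), (k + ∑ U ∈ Fam.filter (· ⊆ C), (#U - k))
      = 2 ^ t * k + ∑ U ∈ Fam, (#U - k) * #(univ.filter fun C : Finset (Fin t) => U ⊆ C) := by
    rw [sum_add_distrib, sum_const, card_univ, Fintype.card_finset, Fintype.card_fin, smul_eq_mul]
    congr 1
    simp_rw [sum_filter]
    rw [sum_comm]
    refine sum_congr rfl fun U _ => ?_
    rw [← sum_filter, sum_const, smul_eq_mul, mul_comm]
  have step3 : ∑ U ∈ Fam, (#U - k) * #(univ.filter fun C : Finset (Fin t) => U ⊆ C)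
      ≤ ∑ U ∈ Fam, 2 ^ (t - k - 1) := by
    refine sum_le_sum fun U _ => ?_
    calc (#U - k) * #(univ.filter fun C : Finset (Fin t) => U ⊆ C)
        ≤ (#U - k) * 2 ^ (t - #U) := Nat.mul_le_mul_left _ (card_supersets_le U)
      _ ≤ 2 ^ (t - k - 1) := sub_mul_pow_le (by simpa using card_le_univ U)
  have step4 : ∑ U ∈ Fam, (#U - k) * #(univ.filter fun C : Finset (Fin t) => U ⊆ C) ≤ 2 ^ t := by
    rcases Nat.lt_or_ge k t with h | h
    · refine step3.trans ?_
      rw [sum_const, smul_eq_mul]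
      calc #Fam * 2 ^ (t - k - 1) ≤ 2 ^ k * 2 ^ (t - k - 1) := Nat.mul_le_mul_right _ hFam
        _ = 2 ^ (k + (t - k - 1)) := (pow_add 2 k (t - k - 1)).symm
        _ ≤ 2 ^ t := Nat.pow_le_pow_right (by norm_num) (by omega)
    · have hU : ∀ U ∈ Fam, (#U - k) * #(univ.filter fun C : Finset (Fin t) => U ⊆ C) = 0 := by
        intro U _
        have : #U ≤ t := by simpa using card_le_univ U
        have : #U - k = 0 := by omega
        simp [this]
      rw [sum_congr rfl hU, sum_const_zero]
      exact Nat.zero_le _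
  calc ∑ C : Finset (Fin t), maxIn Fam C
      ≤ 2 ^ t * k + ∑ U ∈ Fam, (#U - k) * #(univ.filter fun C : Finset (Fin t) => U ⊆ C) :=
        step1.trans step2.le
    _ ≤ 2 ^ t * k + 2 ^ t := Nat.add_le_add_left step4 _
    _ = 2 ^ t * (k + 1) := by ring


/-- **Size of a positivity family** — registered sub-goal `posFamily_card_le` of stmt-PneNP-10680, verbatim
signature (see `card_posFamily_le_pow`; Dudley's VC bound + Sauer–Shelah): a family of subsets of `Fin t`
(`t ≥ 2`) each of which is the positivity set of a real linear combination of `card ι` fixed functions has at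
most `2 t^{card ι}` members. -/
theorem posFamily_card_le :
    ∀ {t : ℕ}, 2 ≤ t → ∀ {ι : Type} [Fintype ι] (g : ι → Fin t → ℝ) (Fam : Finset (Finset (Fin t))), (∀ U ∈
    Fam, ∃ c : ι → ℝ, U = Finset.univ.filter (fun d => 0 < ∑ i, c i * g i d)) → Fam.card ≤ 2 * t ^
    Fintype.card ι :=
  fun ht _ _ g _ hFam => card_posFamily_le_pow ht g fun U hU => by
    obtain ⟨c, rfl⟩ := hFam U hU
    exact ⟨c, rfl⟩

end

end Summit.PneNP.PneNP.Theorems.XorDoor.TriLine
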